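import Literature.MathematicalPhysics.QuantumFieldTheory.OSData
import HarnessLib

/-!
# Extension by zero of Osterwalder–Schrader data along the species labels

A family of hermitian scalar Euclidean fields satisfying the OS axioms stays one when fields that
vanish identically are adjoined (OS 1973 §6: the axioms for "arbitrary spinor fields" are
componentwise; a zero field has all Schwinger functions with that label equal to `0`). For the
labelled packages of this directory (`OSData ι d`: E0, E0', E1–E4 as fields) this is the
bookkeeping that lets an existence statement quantified over a LARGE species type `ι` (e.g. ALL
gauge-invariant local lattice observables, `YMSpecies G`) be inhabited from OS data for a SMALL
family `κ` (e.g. one field): pull the labels back along `φ : ι → κ` on a set of LIVE labels and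
declare every string touching a dead label to have Schwinger function `0`.

## Main results (no new definitions; the extension is characterised, then shown to exist)

For `T₀ : OSData κ d`, `φ : ι → κ`, `live : ι → Prop` and a labelled family `S` over `ι` with
`S n k = T₀.schwinger n (φ ∘ k)` when every `k i` is live and `S n k = 0` otherwise:

* `isNormalized_of_extendByZero`, `isHermitian_…`, `hasLinearGrowth_…`, `isEuclideanInvariant_…`,
  `isReflectionPositive_…`, `isSymmetric_…`, `hasClusterProperty_…` — each OS axiom of `T₀` passes
  to `S` (E2: the positivity sum of `S` equals the positivity sum of `T₀` for the sub-family of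
  live terms, dead terms being replaced by the zero test function);
* `OSData.exists_extendByZero` — such an `S` exists as `OSData ι d`;
* `hasMassGap_of_extendByZero`, `isNontrivial_of_extendByZero`, `isNonGaussian_of_extendByZero` —
  the full-spectrum gap, non-triviality and non-Gaussianity transfer (a live label `s` reads the
  field `φ s` of `T₀`).

## References

* K. Osterwalder, R. Schrader, *Axioms for Euclidean Green's functions*, CMP 31 (1973) 83–112,
  §6 (several fields); *II*, CMP 42 (1975) 281–305, §2.
* J. Glimm, A. Jaffe, *Quantum Physics* (2nd ed. 1987), §6.1.
-/

open scoped SchwartzMap ComplexConjugate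
open MeasureTheory Filter Topology Complex
open Literature.MathematicalPhysics.AQFT Literature.MathematicalPhysics.QuantumLattice

noncomputable section

namespace Literature.MathematicalPhysics.QuantumFieldTheory

variable {ι κ : Type} {d : ℕ} [NeZero d]

/-! ### Label bookkeeping -/

section Labels

variable {live : ι → Prop}

/-- A string reversed is live iff the string is live. [folklore] -/
theorem forall_live_comp_rev_iff {n : ℕ} (k : Fin n → ι) :
    (∀ i, live ((k ∘ Fin.rev) i)) ↔ ∀ i, live (k i) :=
  ⟨fun h i => by simpa using h (Fin.rev i), fun h i => h _⟩

/-- A permuted string is live iff the string is live. [folklore] -/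
theorem forall_live_comp_perm_iff {n : ℕ} (k : Fin n → ι) (π : Equiv.Perm (Fin n)) :
    (∀ i, live ((k ∘ π) i)) ↔ ∀ i, live (k i) :=
  ⟨fun h i => by simpa using h (π.symm i), fun h i => h _⟩

/-- An appended string is live iff both pieces are. [folklore] -/
theorem forall_live_append_iff {n m : ℕ} (u : Fin n → ι) (v : Fin m → ι) :
    (∀ l, live (Fin.append u v l)) ↔ (∀ a, live (u a)) ∧ ∀ b, live (v b) := by
  constructor
  · intro h
    exact ⟨fun a => by simpa using h (Fin.castAdd m a), fun b => by simpa using h (Fin.natAdd n b)⟩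
  · rintro ⟨hu, hv⟩ l
    refine Fin.addCases (fun a => ?_) (fun b => ?_) l
    · simpa using hu a
    · simpa using hv b

/-- Pulling labels back commutes with appending strings. [folklore] -/
theorem comp_append (φ : ι → κ) {n m : ℕ} (u : Fin n → ι) (v : Fin m → ι) :
    φ ∘ Fin.append u v = Fin.append (φ ∘ u) (φ ∘ v) := by
  funext l
  refine Fin.addCases (fun a => ?_) (fun b => ?_) l <;> simp

end Labels

/-! ### Zero test functions -/

section ZeroTest

/-- The zero test function is time-ordered (empty support). [folklore] -/
theorem isTimeOrdered_zero {n : ℕ} :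
    IsTimeOrdered (0 : 𝓢((Fin n → EuclideanSpace ℝ (Fin d)), ℂ)) := by
  intro x hx
  simp [tsupport, FunLike.coe_zero] at hx

/-- The OS adjoint of the zero test function vanishes pointwise. [folklore] -/
theorem osAdjoint_zero_apply {n : ℕ} (x : Fin n → EuclideanSpace ℝ (Fin d)) :
    osAdjoint (0 : 𝓢((Fin n → EuclideanSpace ℝ (Fin d)), ℂ)) x = 0 := by
  simp [osAdjoint_apply]

/-- `0 = θ0* ⊗ G` in appended variables. [folklore] -/
theorem isAppendTensorOf_zero_left {n m : ℕ} (G : 𝓢((Fin m → EuclideanSpace ℝ (Fin d)), ℂ)) :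
    IsAppendTensorOf (0 : 𝓢((Fin (n + m) → EuclideanSpace ℝ (Fin d)), ℂ))
      (osAdjoint (0 : 𝓢((Fin n → EuclideanSpace ℝ (Fin d)), ℂ))) G := by
  intro x
  simp

omit [NeZero d] in
/-- `0 = F ⊗ 0` in appended variables. [folklore] -/
theorem isAppendTensorOf_zero_right {n m : ℕ} (F : 𝓢((Fin n → EuclideanSpace ℝ (Fin d)), ℂ)) :
    IsAppendTensorOf (0 : 𝓢((Fin (n + m) → EuclideanSpace ℝ (Fin d)), ℂ)) F
      (0 : 𝓢((Fin m → EuclideanSpace ℝ (Fin d)), ℂ)) := by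
  intro x
  simp

end ZeroTest

/-! ### The OS axioms pass to an extension by zero -/

section Axioms

/-- E0 (normalisation) of the extension: the empty string is live. [folklore] -/
theorem isNormalized_of_extendByZero (T₀ : OSData κ d) (φ : ι → κ) (live : ι → Prop)
    {S : LabelledSchwingerFamily ι (EuclideanSpace ℝ (Fin d))}
    (hlive : ∀ (n : ℕ) (k : Fin n → ι), (∀ i, live (k i)) → S n k = T₀.schwinger n (φ ∘ k)) :
    S.IsNormalized := by
  intro k F
  rw [hlive 0 k fun i => i.elim0]
  exact T₀.normalized _ F

/-- E0 (hermiticity) of the extension. [folklore] -/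
theorem isHermitian_of_extendByZero (T₀ : OSData κ d) (φ : ι → κ) (live : ι → Prop)
    {S : LabelledSchwingerFamily ι (EuclideanSpace ℝ (Fin d))}
    (hlive : ∀ (n : ℕ) (k : Fin n → ι), (∀ i, live (k i)) → S n k = T₀.schwinger n (φ ∘ k))
    (hdead : ∀ (n : ℕ) (k : Fin n → ι), (¬ ∀ i, live (k i)) → S n k = 0) :
    S.IsHermitian := by
  intro n k F hF
  by_cases h : ∀ i, live (k i)
  · have h' : ∀ i, live ((k ∘ Fin.rev) i) := (forall_live_comp_rev_iff k).2 h
    rw [hlive n k h, hlive n _ h']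
    exact T₀.hermitian n (φ ∘ k) F hF
  · have h' : ¬ ∀ i, live ((k ∘ Fin.rev) i) := fun h'' => h ((forall_live_comp_rev_iff k).1 h'')
    rw [hdead n k h, hdead n _ h']
    simp

/-- E0' (linear growth) of the extension: the constants of `T₀` on the finite alphabet `φ(T)`
(with `α` replaced by `max α 0`). [folklore] -/
theorem hasLinearGrowth_of_extendByZero (T₀ : OSData κ d) (φ : ι → κ) (live : ι → Prop)
    {S : LabelledSchwingerFamily ι (EuclideanSpace ℝ (Fin d))}
    (hlive : ∀ (n : ℕ) (k : Fin n → ι), (∀ i, live (k i)) → S n k = T₀.schwinger n (φ ∘ k))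
    (hdead : ∀ (n : ℕ) (k : Fin n → ι), (¬ ∀ i, live (k i)) → S n k = 0) :
    S.HasLinearGrowth := by
  classical
  intro T
  obtain ⟨s, α, β, h⟩ := T₀.linearGrowth (T.image φ)
  refine ⟨s, max α 0, β, fun n k hk F hF => ?_⟩
  have hnn : 0 ≤ (n.factorial : ℝ) ^ β * schwartzNorm (n * s) F :=
    mul_nonneg (Real.rpow_nonneg (Nat.cast_nonneg _) _) (schwartzNorm_nonneg _ _)
  by_cases hl : ∀ i, live (k i)
  · rw [hlive n k hl]
    have hk' : ∀ i, (φ ∘ k) i ∈ T.image φ := fun i => Finset.mem_image_of_mem φ (hk i)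
    calc ‖T₀.schwinger n (φ ∘ k) F‖ ≤ α * (n.factorial : ℝ) ^ β * schwartzNorm (n * s) F :=
          h n (φ ∘ k) hk' F hF
      _ = α * ((n.factorial : ℝ) ^ β * schwartzNorm (n * s) F) := by ring
      _ ≤ max α 0 * ((n.factorial : ℝ) ^ β * schwartzNorm (n * s) F) :=
          mul_le_mul_of_nonneg_right (le_max_left _ _) hnn
      _ = max α 0 * (n.factorial : ℝ) ^ β * schwartzNorm (n * s) F := by ring
  · rw [hdead n k hl]
    calc ‖(0 : 𝓢((Fin n → EuclideanSpace ℝ (Fin d)), ℂ) →L[ℂ] ℂ) F‖ = 0 := by simp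
      _ ≤ max α 0 * ((n.factorial : ℝ) ^ β * schwartzNorm (n * s) F) :=
          mul_nonneg (le_max_right _ _) hnn
      _ = max α 0 * (n.factorial : ℝ) ^ β * schwartzNorm (n * s) F := by ring

/-- E1 (Euclidean invariance) of the extension. [folklore] -/
theorem isEuclideanInvariant_of_extendByZero (T₀ : OSData κ d) (φ : ι → κ) (live : ι → Prop)
    {S : LabelledSchwingerFamily ι (EuclideanSpace ℝ (Fin d))}
    (hlive : ∀ (n : ℕ) (k : Fin n → ι), (∀ i, live (k i)) → S n k = T₀.schwinger n (φ ∘ k))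
    (hdead : ∀ (n : ℕ) (k : Fin n → ι), (¬ ∀ i, live (k i)) → S n k = 0) :
    S.IsEuclideanInvariant := by
  refine ⟨fun n k a F hF => ?_, fun n k R hR F hF => ?_⟩
  · by_cases h : ∀ i, live (k i)
    · rw [hlive n k h]
      exact T₀.invariant.1 n (φ ∘ k) a F hF
    · rw [hdead n k h]
      simp
  · by_cases h : ∀ i, live (k i)
    · rw [hlive n k h]
      exact T₀.invariant.2 n (φ ∘ k) R hR F hF
    · rw [hdead n k h]
      simp

/-- E2 (reflection positivity) of the extension: replace the test function of every term whose
label string is not live by `0`; the positivity sum of `S` is then literally the positivity sum of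
`T₀` for the pulled-back labels. [folklore] -/
theorem isReflectionPositive_of_extendByZero (T₀ : OSData κ d) (φ : ι → κ) (live : ι → Prop)
    {S : LabelledSchwingerFamily ι (EuclideanSpace ℝ (Fin d))}
    (hlive : ∀ (n : ℕ) (k : Fin n → ι), (∀ i, live (k i)) → S n k = T₀.schwinger n (φ ∘ k))
    (hdead : ∀ (n : ℕ) (k : Fin n → ι), (¬ ∀ i, live (k i)) → S n k = 0) :
    S.IsReflectionPositive := by
  classical
  intro N deg lab F hF H hH
  -- live terms
  let J : Fin N → Prop := fun j => ∀ i, live (lab j i)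
  let F' : (j : Fin N) → 𝓢((Fin (deg j) → EuclideanSpace ℝ (Fin d)), ℂ) :=
    fun j => if J j then F j else 0
  let H' : (i j : Fin N) → 𝓢((Fin (deg i + deg j) → EuclideanSpace ℝ (Fin d)), ℂ) :=
    fun i j => if J i ∧ J j then H i j else 0
  have hF' : ∀ j, IsTimeOrdered (F' j) := by
    intro j
    by_cases hj : J j
    · simp only [F', if_pos hj]; exact hF j
    · simp only [F', if_neg hj]; exact isTimeOrdered_zero
  have hH' : ∀ i j, IsAppendTensorOf (H' i j) (osAdjoint (F' i)) (F' j) := by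
    intro i j
    by_cases hi : J i
    · by_cases hj : J j
      · simp only [H', F', if_pos hi, if_pos hj, if_pos (And.intro hi hj)]
        exact hH i j
      · simp only [H', F', if_pos hi, if_neg hj, if_neg (fun h : J i ∧ J j => hj h.2)]
        exact isAppendTensorOf_zero_right _
    · simp only [H', F', if_neg hi, if_neg (fun h : J i ∧ J j => hi h.1)]
      exact isAppendTensorOf_zero_left _
  have key := T₀.reflectionPositive N deg (fun j => φ ∘ lab j) F' hF' H' hH'
  dsimp only at key ⊢
  -- termwise identification of the two sums
  have hterm : ∀ i j,
      S (deg i + deg j) (Fin.append (lab i ∘ Fin.rev) (lab j)) (H i j) =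
        T₀.schwinger (deg i + deg j) (Fin.append ((φ ∘ lab i) ∘ Fin.rev) (φ ∘ lab j)) (H' i j) := by
    intro i j
    by_cases hij : J i ∧ J j
    · have hl : ∀ l, live (Fin.append (lab i ∘ Fin.rev) (lab j) l) :=
        (forall_live_append_iff _ _).2 ⟨(forall_live_comp_rev_iff (lab i)).2 hij.1, hij.2⟩
      rw [hlive _ _ hl, comp_append]
      simp only [H', if_pos hij]
      rfl
    · have hl : ¬ ∀ l, live (Fin.append (lab i ∘ Fin.rev) (lab j) l) := fun hl =>
        hij (((forall_live_append_iff _ _).1 hl).imp_left (forall_live_comp_rev_iff (lab i)).1)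
      rw [hdead _ _ hl]
      simp [H', if_neg hij]
  simp only [hterm]
  exact key

/-- E3 (symmetry) of the extension. [folklore] -/
theorem isSymmetric_of_extendByZero (T₀ : OSData κ d) (φ : ι → κ) (live : ι → Prop)
    {S : LabelledSchwingerFamily ι (EuclideanSpace ℝ (Fin d))}
    (hlive : ∀ (n : ℕ) (k : Fin n → ι), (∀ i, live (k i)) → S n k = T₀.schwinger n (φ ∘ k))
    (hdead : ∀ (n : ℕ) (k : Fin n → ι), (¬ ∀ i, live (k i)) → S n k = 0) :
    S.IsSymmetric := by
  intro n k π F hF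
  by_cases h : ∀ i, live (k i)
  · have h' : ∀ i, live ((k ∘ π) i) := (forall_live_comp_perm_iff k π).2 h
    rw [hlive n k h, hlive n _ h']
    exact T₀.symmetric n (φ ∘ k) π F hF
  · have h' : ¬ ∀ i, live ((k ∘ π) i) := fun h'' => h ((forall_live_comp_perm_iff k π).1 h'')
    rw [hdead n k h, hdead n _ h']
    simp

/-- E4 (cluster property) of the extension: live strings cluster as in `T₀`; a string touching a
dead label has identically vanishing terms. [folklore] -/
theorem hasClusterProperty_of_extendByZero (T₀ : OSData κ d) (φ : ι → κ) (live : ι → Prop)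
    {S : LabelledSchwingerFamily ι (EuclideanSpace ℝ (Fin d))}
    (hlive : ∀ (n : ℕ) (k : Fin n → ι), (∀ i, live (k i)) → S n k = T₀.schwinger n (φ ∘ k))
    (hdead : ∀ (n : ℕ) (k : Fin n → ι), (¬ ∀ i, live (k i)) → S n k = 0) :
    S.HasClusterProperty := by
  intro n m k k' F G hF hG a ha0 ha H hH
  by_cases hk : ∀ i, live (k i)
  · have hkr : ∀ i, live ((k ∘ Fin.rev) i) := (forall_live_comp_rev_iff k).2 hk
    by_cases hk' : ∀ i, live (k' i)
    · have happ : ∀ l, live (Fin.append (k ∘ Fin.rev) k' l) :=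
        (forall_live_append_iff _ _).2 ⟨hkr, hk'⟩
      have key := T₀.cluster n m (φ ∘ k) (φ ∘ k') F G hF hG a ha0 ha H hH
      rw [hlive n _ hkr, hlive m _ hk']
      simp only [hlive (n + m) _ happ, comp_append]
      exact key
    · have happ : ¬ ∀ l, live (Fin.append (k ∘ Fin.rev) k' l) := fun h =>
        hk' ((forall_live_append_iff _ _).1 h).2
      simp only [hdead (n + m) _ happ, hdead m _ hk', zero_apply, mul_zero, sub_zero]
      exact tendsto_const_nhds
  · have hkr : ¬ ∀ i, live ((k ∘ Fin.rev) i) := fun h => hk ((forall_live_comp_rev_iff k).1 h)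
    have happ : ¬ ∀ l, live (Fin.append (k ∘ Fin.rev) k' l) := fun h =>
      hkr ((forall_live_append_iff _ _).1 h).1
    simp only [hdead (n + m) _ happ, hdead n _ hkr, zero_apply, zero_mul, sub_zero]
    exact tendsto_const_nhds

end Axioms

/-! ### Existence of the extension, and what it inherits -/

namespace OSData

/-- **Extension by zero of OS data along the labels.** For OS data `T₀` over `κ`, a label map
`φ : ι → κ` and a set of live labels, there are OS data `T` over `ι` whose Schwinger function of a
label string `k` is that of `T₀` at `φ ∘ k` when every label of `k` is live, and `0` otherwise
(several-field form of the OS axioms, OS 1973 §6, with the dead fields identically zero).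
[cite: OS1973, §6] -/
theorem exists_extendByZero (T₀ : OSData κ d) (φ : ι → κ) (live : ι → Prop) :
    ∃ T : OSData ι d,
      (∀ (n : ℕ) (k : Fin n → ι), (∀ i, live (k i)) → T.schwinger n k = T₀.schwinger n (φ ∘ k)) ∧
        ∀ (n : ℕ) (k : Fin n → ι), (¬ ∀ i, live (k i)) → T.schwinger n k = 0 := by
  classical
  let S : LabelledSchwingerFamily ι (EuclideanSpace ℝ (Fin d)) :=
    fun n k => if ∀ i, live (k i) then T₀.schwinger n (φ ∘ k) else 0
  have hlive : ∀ (n : ℕ) (k : Fin n → ι), (∀ i, live (k i)) → S n k = T₀.schwinger n (φ ∘ k) :=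
    fun n k h => if_pos h
  have hdead : ∀ (n : ℕ) (k : Fin n → ι), (¬ ∀ i, live (k i)) → S n k = 0 :=
    fun n k h => if_neg h
  exact ⟨⟨S, isNormalized_of_extendByZero T₀ φ live hlive,
      isHermitian_of_extendByZero T₀ φ live hlive hdead,
      hasLinearGrowth_of_extendByZero T₀ φ live hlive hdead,
      isEuclideanInvariant_of_extendByZero T₀ φ live hlive hdead,
      isReflectionPositive_of_extendByZero T₀ φ live hlive hdead,
      isSymmetric_of_extendByZero T₀ φ live hlive hdead,
      hasClusterProperty_of_extendByZero T₀ φ live hlive hdead⟩, hlive, hdead⟩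

/-- **The full-spectrum mass gap passes to the extension**: live string pairs cluster as in `T₀`,
and every truncated function touching a dead label vanishes identically.
[cite: GlimmJaffe1987, §6.1] -/
theorem hasMassGap_of_extendByZero (T₀ : OSData κ d) (φ : ι → κ) (live : ι → Prop)
    {T : OSData ι d}
    (hlive : ∀ (n : ℕ) (k : Fin n → ι), (∀ i, live (k i)) →
      T.schwinger n k = T₀.schwinger n (φ ∘ k))
    (hdead : ∀ (n : ℕ) (k : Fin n → ι), (¬ ∀ i, live (k i)) → T.schwinger n k = 0) {Δ : ℝ}
    (h : T₀.HasMassGap Δ) :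
    T.HasMassGap Δ := by
  intro n m k k' F G hF hG
  by_cases hk : ∀ i, live (k i)
  · have hkr : ∀ i, live ((k ∘ Fin.rev) i) := (forall_live_comp_rev_iff k).2 hk
    by_cases hk' : ∀ i, live (k' i)
    · have happ : ∀ l, live (Fin.append (k ∘ Fin.rev) k' l) :=
        (forall_live_append_iff _ _).2 ⟨hkr, hk'⟩
      obtain ⟨C, hC⟩ := h n m (φ ∘ k) (φ ∘ k') F G hF hG
      refine ⟨C, fun t ht H hH => ?_⟩
      have := hC t ht H hH
      rw [hlive n _ hkr, hlive m _ hk']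
      simp only [hlive (n + m) _ happ, comp_append] at this ⊢
      exact this
    · have happ : ¬ ∀ l, live (Fin.append (k ∘ Fin.rev) k' l) := fun h =>
        hk' ((forall_live_append_iff _ _).1 h).2
      refine ⟨0, fun t _ H _ => ?_⟩
      simp [hdead (n + m) _ happ, hdead m _ hk']
  · have hkr : ¬ ∀ i, live ((k ∘ Fin.rev) i) := fun h => hk ((forall_live_comp_rev_iff k).1 h)
    have happ : ¬ ∀ l, live (Fin.append (k ∘ Fin.rev) k' l) := fun h =>
      hkr ((forall_live_append_iff _ _).1 h).1
    refine ⟨0, fun t _ H _ => ?_⟩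
    simp [hdead (n + m) _ happ, hdead n _ hkr]

/-- A live label `s` of the extension reads the field `φ s` of `T₀` on constant strings.
[folklore] -/
theorem schwinger_const_of_extendByZero (T₀ : OSData κ d) (φ : ι → κ) (live : ι → Prop)
    {T : OSData ι d}
    (hlive : ∀ (n : ℕ) (k : Fin n → ι), (∀ i, live (k i)) →
      T.schwinger n k = T₀.schwinger n (φ ∘ k))
    {s : ι} (hs : live s) (n : ℕ) :
    T.schwinger n (fun _ => s) = T₀.schwinger n (fun _ => φ s) :=
  hlive n (fun _ => s) fun _ => hs

/-- **Non-triviality passes to a live label.** [folklore] -/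
theorem isNontrivial_of_extendByZero (T₀ : OSData κ d) (φ : ι → κ) (live : ι → Prop)
    {T : OSData ι d}
    (hlive : ∀ (n : ℕ) (k : Fin n → ι), (∀ i, live (k i)) →
      T.schwinger n k = T₀.schwinger n (φ ∘ k))
    {s : ι} (hs : live s) (h : T₀.IsNontrivial (φ s)) :
    T.IsNontrivial s := by
  obtain ⟨F, G, H, hF, hG, hH, hne⟩ := h
  refine ⟨F, G, H, hF, hG, hH, ?_⟩
  simpa only [schwinger_const_of_extendByZero T₀ φ live hlive hs] using hne

/-- **Non-Gaussianity passes to a live label.** [folklore] -/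
theorem isNonGaussian_of_extendByZero (T₀ : OSData κ d) (φ : ι → κ) (live : ι → Prop)
    {T : OSData ι d}
    (hlive : ∀ (n : ℕ) (k : Fin n → ι), (∀ i, live (k i)) →
      T.schwinger n k = T₀.schwinger n (φ ∘ k))
    {s : ι} (hs : live s) (h : T₀.IsNonGaussian (φ s)) :
    T.IsNonGaussian s := by
  obtain ⟨f, g, h', Ffgh, Fgh, Ffh, Ffg, Ff, Fg, Fh, h1, h2, h3, h4, h5, h6, h7, h8, hne⟩ := h
  refine ⟨f, g, h', Ffgh, Fgh, Ffh, Ffg, Ff, Fg, Fh, h1, h2, h3, h4, h5, h6, h7, h8, ?_⟩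
  simpa only [schwinger_const_of_extendByZero T₀ φ live hlive hs] using hne

end OSData

end Literature.MathematicalPhysics.QuantumFieldTheory

end
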